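import Summits.Ventures.HSemireg.WedgeHankelClassSpaceRaisingCharP
import Summits.Ventures.HSemireg.WedgeHankelClassSpaceShearExponential
import Summits.Ventures.HSemireg.WedgeHankelSubstitutionShearFlagIntersections

/-!
# Venture HSemireg — THE JORDAN TYPE OF THE RAISING OPERATOR: `ker e^k` and `range e^k` are spanned by spikes, `dim ker e^k = #{i ≤ n : i + k > n or (i+1)⋯(i+k) = 0 in K}`;
# when `n!` is a unit this is `min(k, n+1)` (one block), and in characteristic `p` it is `#{i : i mod p + k ≥ p or i + k > n} = ⌊n/p⌋·min(k,p) + min(k, n mod p + 1)` —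
# **the nilpotent `e` and the unipotent shear `SbC(1 λ 0 1)` have the SAME JORDAN TYPE over every field** (`dim ker e^k = dim ker (S − 1)^k` for all `k`)

HONEST FRAMING. Part of the Lean index of the computation cell `pub-hsemireg` (seat p10 gen 23, Sunday typer «UNIFORM-IN-n»).
Finite-dimensional linear algebra of endomorphisms of th-7's class space ONLY: no variety, no cohomology theory, no sheaf, no Ext group, no semiregularity map;
nothing here says that HC / HC_CM / HC_AV holds; no Literature fact is declared or used.  Custodian versions as in `WedgeHankelSiegelIdeal` (1/3) and `WedgeHankelFrameChange`;
the dictionary (`e` = the infinitesimal shear on `Sym^n`; its chains `E_{jp}, …, E_{jp+p−1}` break where `p ∣ i + 1`) is QUOTED, never asserted.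

WHAT IS IN THE TREE.  K27 `pow_raising_spikeBasis_of_le` / `_eq_zero` (`e^k E_i = (i+1)⋯(i+k) E_{i+k}`, zero past the top); K28 `repr_pow_raising_spikeBasis` (coordinates of
`e^k E_i`); K35 `mem_span_range_restrict_iff`, `finrank_span_range_restrict` (spans of sub-families of a basis), `finrank_ker_pow_shear_char_eq_card` (`dim ker (S−1)^k = #{m :
p ≤ m mod p + k ∨ n < m + k}`); K1 `finrank_ker_SbC_shear_sub_one_pow_char` (`= ⌊n/p⌋·min(k,p) + min(k, n mod p + 1)`); K43 (`e^p = 0`).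
THIS FILE (namespace `Summit.Ventures.HSemireg.Wedge.HankelFrameChange` continued; imports K43, K28, K35; K27's hypotheses `hE hEtop`):
* §383 EVERY FIELD: `repr_pow_raising` (the `(i+k)`-coordinate of `e^k v` is `(i+1)⋯(i+k) · v_i`), **`ker_pow_raising_eq_span`: `ker e^k = span{E_i : n < i + k ∨ (i+1)⋯(i+k) = 0}`**,
  **`finrank_ker_pow_raising_eq_card`**, `finrank_ker_pow_raising_of_factorial` (`n!` a unit: `dim ker e^k = min k (n+1)`, a single Jordan block).
* §384 CHARACTERISTIC `p`: **`ascFactorial_succ_cast_eq_zero_iff_charP`: `(i+1)⋯(i+k) = 0 in K ↔ p ≤ i mod p + k`**, **`finrank_ker_pow_raising_charP_eq_card`**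
  (`dim ker e^k = #{i : p ≤ i mod p + k ∨ n < i + k}`), **`finrank_ker_pow_raising_eq_finrank_ker_pow_shear_charP`: `dim ker e^k = dim ker (SbC(1 λ 0 1) − 1)^k`** for every
  `k` and every `λ ≠ 0` — the SAME JORDAN TYPE — and the closed form **`finrank_ker_pow_raising_charP`: `dim ker e^k = ⌊n/p⌋·min(k,p) + min(k, n mod p + 1)`**, with the rank
  `finrank_range_pow_raising_charP_add`.
NOT typed here: an explicit conjugation between `e` and `S − 1` (none is claimed; only the types agree); the lowering operator (conjugate by the Weyl element, L3); anything
Ext-side.  New names only.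
-/

open Module

namespace Summit.Ventures.HSemireg.Wedge.HankelFrameChange

open Summit.Ventures.HSemireg.Wedge Summit.Ventures.HSemireg.Wedge.Kunneth Summit.Ventures.HSemireg.Wedge.Hankel
  Summit.Ventures.HSemireg.Wedge.BasisFree Summit.Ventures.HSemireg.Wedge.HankelSiegel Summit.Ventures.HSemireg.Wedge.HankelSiegelIdeal
  Summit.Ventures.HSemireg.Wedge.KunnethKernel Summit.Ventures.HSemireg.Wedge.HankelRankOne Summit.Ventures.HSemireg.Wedge.KernelDuality

variable (K : Type*) [Field K] {n : ℕ}

section RaisingType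

variable {e : Module.End K (spikeSpan K n)}
  (hE : ∀ (i : Fin (n + 1)) (hi : (i : ℕ) < n), e (spikeBasis K n i) = (((i : ℕ) : K) + 1) • spikeBasis K n ⟨(i : ℕ) + 1, by omega⟩) (hEtop : e (spikeBasis K n (Fin.last n)) = 0)
include hE hEtop

/-! ## §383. The kernel flag of the raising operator over every field -/

/-- **the `(i+k)`-coordinate of `e^k v` is `(i+1)⋯(i+k) · v_i`** (`i + k ≤ n`). -/
theorem repr_pow_raising (v : spikeSpan K n) (k : ℕ) (i : Fin (n + 1)) (hik : (i : ℕ) + k ≤ n) :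
    (spikeBasis K n).repr ((e ^ k) v) ⟨(i : ℕ) + k, by omega⟩ = ((((i : ℕ) + 1).ascFactorial k : ℕ) : K) * (spikeBasis K n).repr v i := by
  classical
  conv_lhs => rw [← (spikeBasis K n).sum_repr v]
  rw [map_sum, map_sum, Finsupp.finsetSum_apply]
  simp_rw [map_smul, Finsupp.smul_apply, repr_pow_raising_spikeBasis K hE hEtop, smul_eq_mul]
  rw [Finset.sum_eq_single i (fun j _ hj => ?_) (fun h => absurd (Finset.mem_univ i) h)]
  · rw [if_pos rfl, mul_comm]
  · rw [if_neg (fun h => hj (Fin.ext (by omega))), mul_zero]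

/-- **`ker e^k = span{E_i : n < i + k ∨ (i+1)⋯(i+k) = 0 in K}`** (every field, every `n`, `k`): `e^k` maps the other spikes to non-zero multiples of DISTINCT spikes. -/
theorem ker_pow_raising_eq_span (k : ℕ) :
    LinearMap.ker (e ^ k) = Submodule.span K (Set.range fun i : {i : Fin (n + 1) // n < (i : ℕ) + k ∨ ((((i : ℕ) + 1).ascFactorial k : ℕ) : K) = 0} => spikeBasis K n i) := by
  refine le_antisymm (fun v hv => ?_) ?_
  · rw [mem_span_range_restrict_iff]
    intro i hi
    rw [not_or, not_lt] at hi
    have h := repr_pow_raising K hE hEtop v k i hi.1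
    rw [LinearMap.mem_ker.mp hv, map_zero, Finsupp.zero_apply, eq_comm, mul_eq_zero] at h
    exact h.resolve_left hi.2
  · rw [Submodule.span_le]
    rintro _ ⟨i, rfl⟩
    rw [SetLike.mem_coe, LinearMap.mem_ker]
    rcases i.2 with h | h
    · exact pow_raising_spikeBasis_eq_zero K hE hEtop i.1 h
    · by_cases hik : ((i.1 : Fin (n + 1)) : ℕ) + k ≤ n
      · rw [pow_raising_spikeBasis_of_le K hE i.1 hik, h, zero_smul]
      · exact pow_raising_spikeBasis_eq_zero K hE hEtop i.1 (by omega)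

/-- **`dim ker e^k = #{i ≤ n : n < i + k ∨ (i+1)⋯(i+k) = 0 in K}`.** -/
theorem finrank_ker_pow_raising_eq_card (k : ℕ) [DecidablePred fun i : Fin (n + 1) => n < (i : ℕ) + k ∨ ((((i : ℕ) + 1).ascFactorial k : ℕ) : K) = 0] :
    finrank K ↥(LinearMap.ker (e ^ k))
      = (Finset.univ.filter fun i : Fin (n + 1) => n < (i : ℕ) + k ∨ ((((i : ℕ) + 1).ascFactorial k : ℕ) : K) = 0).card := by
  rw [ker_pow_raising_eq_span K hE hEtop k, finrank_span_range_restrict K (spikeBasis K n)]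

/-- when `n!` is a unit no coefficient vanishes: **`dim ker e^k = min k (n+1)`** (a single Jordan block of length `n + 1`). -/
theorem finrank_ker_pow_raising_of_factorial (hfac : ((n.factorial : ℕ) : K) ≠ 0) (k : ℕ) : finrank K ↥(LinearMap.ker (e ^ k)) = min k (n + 1) := by
  classical
  rw [finrank_ker_pow_raising_eq_card K hE hEtop k]
  have hne : ∀ i : Fin (n + 1), (i : ℕ) + k ≤ n → ((((i : ℕ) + 1).ascFactorial k : ℕ) : K) ≠ 0 := by
    intro i hik h0
    apply hfac
    have hdvd : ((i : ℕ) + 1).ascFactorial k ∣ n.factorial := by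
      rw [Nat.ascFactorial_eq_div]
      -- `(i+k)! / i! ∣ n!` since `(i+k)! = i! · ((i+1).ascFactorial k)` and `(i+k)! ∣ n!`
      have h1 : ((i : ℕ) + k).factorial = (i : ℕ).factorial * ((i : ℕ) + 1).ascFactorial k := Nat.factorial_mul_ascFactorial (i : ℕ) k ▸ rfl
      rw [h1, Nat.mul_div_cancel_left _ (Nat.factorial_pos _)]
      exact dvd_trans (Dvd.intro_left _ h1.symm) (Nat.factorial_dvd_factorial hik)
    obtain ⟨c, hc⟩ := hdvd
    rw [hc, Nat.cast_mul, h0, zero_mul]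
  have hf : (Finset.univ.filter fun i : Fin (n + 1) => n < (i : ℕ) + k ∨ ((((i : ℕ) + 1).ascFactorial k : ℕ) : K) = 0)
      = Finset.univ.filter fun i : Fin (n + 1) => n < (i : ℕ) + k := by
    apply Finset.filter_congr
    intro i _
    exact ⟨fun h => h.elim id fun h0 => by by_contra hik; exact hne i (by omega) h0, Or.inl⟩
  rw [hf]
  -- count `{i ≤ n : n − k < i}`: the map `j ↦ n − j` from `range (min k (n+1))`
  have hcard : (Finset.univ.filter fun i : Fin (n + 1) => n < (i : ℕ) + k) = (Finset.range (min k (n + 1))).image fun j => (⟨n - j, by omega⟩ : Fin (n + 1)) := by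
    ext i
    simp only [Finset.mem_filter, Finset.mem_univ, true_and, Finset.mem_image, Finset.mem_range, Fin.ext_iff]
    constructor
    · intro h
      exact ⟨n - (i : ℕ), by have := i.2; omega, by have := i.2; omega⟩
    · rintro ⟨j, hj, hji⟩
      omega
  rw [hcard, Finset.card_image_of_injOn, Finset.card_range]
  intro j hj j' hj' h
  simp only [Finset.coe_range, Set.mem_Iio] at hj hj'
  have := congr_arg Fin.val h
  simp only at this
  omega

/-! ## §384. Characteristic `p`: the same Jordan type as the shear -/

omit hE hEtop in
/-- **`(i+1)(i+2)⋯(i+k) = 0` in characteristic `p` iff `p ≤ i mod p + k`** (one of the `k` consecutive integers after `i` is a multiple of `p`). -/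
theorem ascFactorial_succ_cast_eq_zero_iff_charP (p : ℕ) [Fact p.Prime] [CharP K p] (i k : ℕ) : (((i + 1).ascFactorial k : ℕ) : K) = 0 ↔ p ≤ i % p + k := by
  have hp : p.Prime := Fact.out
  rw [CharP.cast_eq_zero_iff K p, Nat.ascFactorial_eq_prod_range, Prime.dvd_finsetProd_iff hp.prime]
  have hdm := Nat.div_add_mod i p
  have hr := Nat.mod_lt i hp.pos
  constructor
  · rintro ⟨j, hj, hdvd⟩
    rw [Finset.mem_range] at hj
    have h1 : p ∣ i % p + 1 + j := by
      have e1 : i + 1 + j = p * (i / p) + (i % p + 1 + j) := by omega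
      rw [e1] at hdvd
      exact (Nat.dvd_add_right (Dvd.intro _ rfl)).mp hdvd
    have h2 := Nat.le_of_dvd (by omega) h1
    omega
  · intro h
    refine ⟨p - 1 - i % p, Finset.mem_range.mpr (by omega), Dvd.intro (i / p + 1) ?_⟩
    rw [Nat.mul_add_one]
    omega

/-- **`dim ker e^k = #{i ≤ n : p ≤ i mod p + k ∨ n < i + k}`** in characteristic `p`. -/
theorem finrank_ker_pow_raising_charP_eq_card (p : ℕ) [Fact p.Prime] [CharP K p] (k : ℕ) :
    finrank K ↥(LinearMap.ker (e ^ k)) = (Finset.univ.filter fun i : Fin (n + 1) => p ≤ (i : ℕ) % p + k ∨ n < (i : ℕ) + k).card := by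
  classical
  rw [finrank_ker_pow_raising_eq_card K hE hEtop k]
  congr 1
  apply Finset.filter_congr
  intro i _
  rw [ascFactorial_succ_cast_eq_zero_iff_charP K p]
  exact Or.comm

/-- **THE RAISING OPERATOR AND THE SHEAR HAVE THE SAME JORDAN TYPE: `dim ker e^k = dim ker (SbC(1 λ 0 1) − 1)^k`** for every `k`, every `λ ≠ 0`, in every characteristic `p`
(both count the Jordan vectors `m` with `m mod p + k ≥ p` or `m + k > n`, K21/K35). -/
theorem finrank_ker_pow_raising_eq_finrank_ker_pow_shear_charP (p : ℕ) [Fact p.Prime] [CharP K p] {lam : K} (hlam : lam ≠ 0) (k : ℕ) :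
    finrank K ↥(LinearMap.ker (e ^ k)) = finrank K ↥(LinearMap.ker ((SbC K 1 lam 0 1 (n := n) - 1) ^ k)) := by
  classical
  rw [finrank_ker_pow_raising_charP_eq_card K hE hEtop p k, finrank_ker_pow_shear_char_eq_card K hlam p k]

/-- **THE CLOSED FORM: `dim ker e^k = ⌊n/p⌋ · min(k, p) + min(k, n mod p + 1)`** in characteristic `p` (Jordan type `(p, …, p, n mod p + 1)`, K1's partition for the shear). -/
theorem finrank_ker_pow_raising_charP (p : ℕ) [Fact p.Prime] [CharP K p] (k : ℕ) :
    finrank K ↥(LinearMap.ker (e ^ k)) = n / p * min k p + min k (n % p + 1) := by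
  rw [finrank_ker_pow_raising_eq_finrank_ker_pow_shear_charP K hE hEtop p (one_ne_zero (α := K)) k, finrank_ker_SbC_shear_sub_one_pow_char K one_ne_zero p k]

/-- the rank: `rank e^k + (⌊n/p⌋ · min(k, p) + min(k, n mod p + 1)) = n + 1` in characteristic `p`. -/
theorem finrank_range_pow_raising_charP_add (p : ℕ) [Fact p.Prime] [CharP K p] (k : ℕ) :
    finrank K ↥(LinearMap.range (e ^ k)) + (n / p * min k p + min k (n % p + 1)) = n + 1 := by
  rw [← finrank_ker_pow_raising_charP K hE hEtop p k, LinearMap.finrank_range_add_finrank_ker, Module.finrank_eq_card_basis (spikeBasis K n), Fintype.card_fin]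

end RaisingType

end Summit.Ventures.HSemireg.Wedge.HankelFrameChange
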